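import Summits.HubbardSuperconductivity.HubbardSuperconductivity.Theorems.AnisotropyChordTransferFibre3N1Row
import Summits.HubbardSuperconductivity.HubbardSuperconductivity.Theorems.AnisotropyChordTransferFibre3B1Instances
import Summits.HubbardSuperconductivity.HubbardSuperconductivity.Theorems.AnisotropyChordTransferFibre3LatticeEnergy
import Summits.HubbardSuperconductivity.HubbardSuperconductivity.Theorems.AnisotropyChordTransferFibre3Resolvent

/-!
# Route `AnisotropyChord` / H0 rotor rung: PartN41-B §6 REGIONS — `OuterEnergyFloor`, `SingleRegionSplit`, `PairRegionSplit` PROVED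

Theory-1 g22's PartN41-B §6 (ported …Fibre3N1Row): the torus splits as `{0} ⊔ block1 ⊔ outer1` (single objects) and
`{0} ⊔ {−K₁} ⊔ blockP ⊔ outerP` (pair objects), and off the blocks the magnon energy is at least
`ε_m = 1 − cos((M₂+1)θ)` (at `k`, and at `k′ = k + K₁` for the pair region), once `4(M₂+2) ≤ L`.
★ `outerEnergyFloor_holds : OuterEnergyFloor L M2`, ★ `singleRegionSplit_holds : SingleRegionSplit L M2`,
★ `pairRegionSplit_holds : PairRegionSplit L M2`.
Tools: integer representatives (`ZMod.valMinAbs`, `B1.toTor_rep`), `epsT = wInt m₁ + wInt m₂` for any representatives,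
`wInt` even / `L`-periodic / monotone on `[0, L/2]` (`wInt_mono`, …LatticeEnergy).
Prover seat `hubbard-h0-rotor-p1` g26 (route lead); helper for stmt-HubbardSuperconductivity-23918 (`--supports`, helper class).
WHAT THIS IS NOT: nothing here proves superconductivity in the Hubbard model; lattice-region bookkeeping of ONE row of ONE
conditional reduction.  Tree imports only; no new definitions; no sorry, no axioms.
-/

set_option linter.dupNamespace false
set_option autoImplicit false

noncomputable section

open scoped BigOperators

namespace Summit.HubbardSuperconductivity.HubbardSuperconductivity.Theorems.AnisotropyChord.Transfer.Fibre3

variable (L : ℕ) [NeZero L]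

namespace OuterMaj

/-! ## Representatives and the energy -/

/-- `1 − cos(2π x.val/L) = wInt r` for any integer representative `r` of `x`. [folklore] -/
theorem one_sub_cos_val_eq_wInt (x : ZMod L) {r : ℤ} (h : ((r : ℤ) : ZMod L) = x) :
    1 - Real.cos (2 * Real.pi * (x.val : ℝ) / L) = wInt L r := by
  unfold wInt
  have hx : (((x.val : ℕ) : ℤ) : ZMod L) = ((r : ℤ) : ZMod L) := by
    rw [h, Int.cast_natCast, ZMod.natCast_zmod_val]
  rw [ZMod.intCast_eq_intCast_iff_dvd_sub] at hx
  obtain ⟨q, hq⟩ := hx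
  have hLr : (L : ℝ) ≠ 0 := by exact_mod_cast NeZero.ne L
  have hq' : (r : ℝ) = (x.val : ℝ) + (L : ℝ) * q := by
    have : (r : ℤ) = (x.val : ℤ) + L * q := by linarith
    exact_mod_cast this
  have : 2 * Real.pi * (r : ℝ) / L = 2 * Real.pi * (x.val : ℝ) / L + (q : ℝ) * (2 * Real.pi) := by
    rw [hq']; field_simp
  rw [this, Real.cos_add_int_mul_two_pi]

/-- `ε_T(k) = wInt r₁ + wInt r₂` for any integer representatives. [folklore] -/
theorem epsT_eq_wInt_reps (k : Tor L) {r1 r2 : ℤ} (h1 : ((r1 : ℤ) : ZMod L) = k.1) (h2 : ((r2 : ℤ) : ZMod L) = k.2) :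
    epsT L k = wInt L r1 + wInt L r2 := by
  have e1 := one_sub_cos_val_eq_wInt L k.1 h1
  have e2 := one_sub_cos_val_eq_wInt L k.2 h2
  unfold epsT
  linarith

/-- `wInt` is `L`-periodic. [folklore] -/
theorem wInt_sub_L (r : ℤ) : wInt L (r - L) = wInt L r := by
  unfold wInt
  have hLr : (L : ℝ) ≠ 0 := by exact_mod_cast NeZero.ne L
  have : 2 * Real.pi * ((r - L : ℤ) : ℝ) / L = 2 * Real.pi * (r : ℝ) / L - 2 * Real.pi := by
    push_cast; field_simp
  rw [this, Real.cos_sub_two_pi]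

omit [NeZero L] in
/-- the block floor in `wInt` form. [folklore] -/
theorem em_eq_wInt (M2 : ℕ) : 1 - Real.cos (2 * Real.pi * (M2 + 1) / L) = wInt L ((M2 + 1 : ℕ) : ℤ) := by
  unfold wInt; push_cast; ring_nf

/-- far representatives have energy above the floor: `M₂+1 ≤ |r|`, `|r| + M₂ + 1 ≤ L` ⇒ `wInt (M₂+1) ≤ wInt r`. [folklore] -/
theorem em_le_wInt (M2 : ℕ) {r : ℤ} (h1 : (M2 : ℤ) + 1 ≤ |r|) (h2 : |r| + (M2 + 1) ≤ (L : ℤ)) :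
    wInt L ((M2 + 1 : ℕ) : ℤ) ≤ wInt L r := by
  have hL : 0 < L := Nat.pos_of_ne_zero (NeZero.ne L)
  by_cases hc : 2 * |r| ≤ (L : ℤ)
  · exact wInt_mono L (s := M2 + 1) (by push_cast; exact h1) hc hL
  · rw [← wInt_natAbs L r, Int.natCast_natAbs, ← wInt_sub_L L |r|]
    refine wInt_mono L (s := M2 + 1) (r := |r| - L) ?_ ?_ hL
    · rw [abs_of_nonpos (by linarith)]; push_cast; linarith
    · rw [abs_of_nonpos (by linarith)]; linarith

/-- the centred representative is at most `L/2` in size, hence `|m| + M₂ + 1 ≤ L` when `4(M₂+2) ≤ L`. [folklore] -/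
theorem abs_valMinAbs_add_le (M2 : ℕ) (hM : 4 * (M2 + 2) ≤ L) (x : ZMod L) :
    |x.valMinAbs| + (M2 + 1) ≤ (L : ℤ) ∧ |x.valMinAbs| + 1 + (M2 + 1) ≤ (L : ℤ) := by
  have h := ZMod.natAbs_valMinAbs_le x
  have e : ((x.valMinAbs.natAbs : ℕ) : ℤ) = |x.valMinAbs| := Int.natCast_natAbs _
  constructor <;> omega

omit [NeZero L] in
/-- `toTor (−1, 0) = −K₁`. [folklore] -/
theorem toTor_neg_one_zero : B1.toTor L ((-1 : ℤ), (0 : ℤ)) = -K1 L := by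
  unfold B1.toTor K1
  ext <;> simp

omit [NeZero L] in
/-- off the single block (and off `0`) one centred coordinate is `≥ M₂ + 1` in size. [folklore] -/
theorem large_rep_of_not_mem_block1 (M2 : ℕ) {k : Tor L} (hk0 : k ≠ 0) (hkb : k ∉ block1 L M2) :
    (M2 : ℤ) + 1 ≤ |k.1.valMinAbs| ∨ (M2 : ℤ) + 1 ≤ |k.2.valMinAbs| := by
  by_contra h
  push Not at h
  obtain ⟨h1, h2⟩ := h
  apply hkb
  unfold block1
  rw [Finset.mem_image]
  refine ⟨((k.1.valMinAbs : ℤ), (k.2.valMinAbs : ℤ)), ?_, B1.toTor_rep L k⟩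
  rw [Finset.mem_erase, B1.mem_box_iff]
  refine ⟨?_, ⟨?_, ?_⟩, ⟨?_, ?_⟩⟩
  · intro hm
    apply hk0
    rw [← B1.toTor_rep L k, hm]
    exact B1.toTor_zero L
  · simp only; linarith [(abs_lt.1 h1).1]
  · simp only; linarith [(abs_lt.1 h1).2]
  · simp only; linarith [(abs_lt.1 h2).1]
  · simp only; linarith [(abs_lt.1 h2).2]

omit [NeZero L] in
/-- off the pair block (and off `0`, `−K₁`): the second coordinate is far, or the first is `≥ M₂+1`, or `≤ −M₂−2`. [folklore] -/
theorem large_rep_of_not_mem_blockP (M2 : ℕ) {k : Tor L} (hk0 : k ≠ 0) (hk1 : k + K1 L ≠ 0) (hkb : k ∉ blockP L M2) :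
    (M2 : ℤ) + 1 ≤ |k.2.valMinAbs| ∨ (M2 : ℤ) + 1 ≤ k.1.valMinAbs ∨ k.1.valMinAbs ≤ -(M2 : ℤ) - 2 := by
  by_contra h
  push Not at h
  obtain ⟨h2, h1a, h1b⟩ := h
  apply hkb
  unfold blockP
  rw [Finset.mem_image]
  refine ⟨((k.1.valMinAbs : ℤ), (k.2.valMinAbs : ℤ)), ?_, B1.toTor_rep L k⟩
  rw [Finset.mem_erase, Finset.mem_erase, Finset.mem_product, Finset.mem_Icc, Finset.mem_Icc]
  refine ⟨?_, ?_, ⟨?_, ?_⟩, ⟨?_, ?_⟩⟩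
  · intro hm
    apply hk1
    rw [← B1.toTor_rep L k, hm, toTor_neg_one_zero, neg_add_cancel]
  · intro hm
    apply hk0
    rw [← B1.toTor_rep L k, hm]
    exact B1.toTor_zero L
  · simp only; linarith
  · simp only; linarith
  · simp only; linarith [(abs_lt.1 h2).1]
  · simp only; linarith [(abs_lt.1 h2).2]

omit [NeZero L] in
/-- coordinates of `k + K₁`. [folklore] -/
theorem add_K1_fst (k : Tor L) : (k + K1 L).1 = k.1 + 1 := rfl
omit [NeZero L] in
/-- coordinates of `k + K₁`. [folklore] -/
theorem add_K1_snd (k : Tor L) : (k + K1 L).2 = k.2 := by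
  show k.2 + 0 = k.2
  rw [add_zero]

/-- ★ `OuterEnergyFloor L M2` holds. [folklore] -/
theorem outerEnergyFloor_holds (M2 : ℕ) : OuterEnergyFloor L M2 := by
  intro hM
  dsimp only
  rw [em_eq_wInt]
  have hrep1 : ∀ k : Tor L, (((k.1.valMinAbs : ℤ)) : ZMod L) = k.1 := fun k => ZMod.coe_valMinAbs k.1
  have hrep2 : ∀ k : Tor L, (((k.2.valMinAbs : ℤ)) : ZMod L) = k.2 := fun k => ZMod.coe_valMinAbs k.2
  have hw0 : ∀ r : ℤ, 0 ≤ wInt L r := fun r => wInt_nonneg L r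
  constructor
  · intro k hk
    unfold outerP at hk
    obtain ⟨hkT, hkb⟩ := Finset.mem_filter.1 hk
    unfold torPrime at hkT
    obtain ⟨hk0, hk1⟩ := (Finset.mem_filter.1 hkT).2
    have hε : epsT L k = wInt L k.1.valMinAbs + wInt L k.2.valMinAbs := epsT_eq_wInt_reps L k (hrep1 k) (hrep2 k)
    have hε' : epsT L (k + K1 L) = wInt L (k.1.valMinAbs + 1) + wInt L k.2.valMinAbs := by
      refine epsT_eq_wInt_reps L (k + K1 L) ?_ ?_
      · rw [add_K1_fst, Int.cast_add, Int.cast_one, hrep1 k]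
      · rw [add_K1_snd]; exact hrep2 k
    obtain ⟨hb1, hb1'⟩ := abs_valMinAbs_add_le L M2 hM k.1
    obtain ⟨hb2, -⟩ := abs_valMinAbs_add_le L M2 hM k.2
    rcases large_rep_of_not_mem_blockP L M2 hk0 hk1 hkb with h | h | h
    · have := em_le_wInt L M2 h hb2
      constructor
      · rw [hε]; linarith [hw0 k.1.valMinAbs]
      · rw [hε']; linarith [hw0 (k.1.valMinAbs + 1)]
    · have e1 := em_le_wInt L M2 (r := k.1.valMinAbs) (by rw [abs_of_nonneg (by linarith)]; linarith) hb1
      have e2 := em_le_wInt L M2 (r := k.1.valMinAbs + 1)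
        (by rw [abs_of_nonneg (by linarith)]; linarith)
        (by rw [abs_of_nonneg (by linarith)]; rw [abs_of_nonneg (by linarith)] at hb1'; linarith)
      constructor
      · rw [hε]; linarith [hw0 k.2.valMinAbs]
      · rw [hε']; linarith [hw0 k.2.valMinAbs]
    · have e1 := em_le_wInt L M2 (r := k.1.valMinAbs) (by rw [abs_of_nonpos (by linarith)]; linarith) hb1
      have e2 := em_le_wInt L M2 (r := k.1.valMinAbs + 1)
        (by rw [abs_of_nonpos (by linarith)]; linarith)
        (by rw [abs_of_nonpos (by linarith)]; rw [abs_of_nonpos (by linarith)] at hb1; linarith)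
      constructor
      · rw [hε]; linarith [hw0 k.2.valMinAbs]
      · rw [hε']; linarith [hw0 k.2.valMinAbs]
  · intro k hk
    unfold outer1 at hk
    obtain ⟨hkU, hkb⟩ := Finset.mem_filter.1 hk
    have hk0 : k ≠ 0 := (Finset.mem_erase.1 hkU).1
    have hε : epsT L k = wInt L k.1.valMinAbs + wInt L k.2.valMinAbs := epsT_eq_wInt_reps L k (hrep1 k) (hrep2 k)
    obtain ⟨hb1, -⟩ := abs_valMinAbs_add_le L M2 hM k.1
    obtain ⟨hb2, -⟩ := abs_valMinAbs_add_le L M2 hM k.2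
    rcases large_rep_of_not_mem_block1 L M2 hk0 hkb with h | h
    · have := em_le_wInt L M2 h hb1
      rw [hε]; linarith [hw0 k.2.valMinAbs]
    · have := em_le_wInt L M2 h hb2
      rw [hε]; linarith [hw0 k.1.valMinAbs]

/-! ## Region splits -/

omit [NeZero L] in
/-- a box point maps to `0` only if it is `(0,0)`, once the box fits: `|p_i| ≤ M < L`. [folklore] -/
theorem toTor_eq_zero_of_small {M : ℕ} (hML : M < L) {p : ℤ × ℤ} (hp1 : |p.1| ≤ M) (hp2 : |p.2| ≤ M)
    (h : B1.toTor L p = 0) : p = 0 := by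
  unfold B1.toTor at h
  have h1 : ((p.1 : ℤ) : ZMod L) = 0 := by have := congrArg Prod.fst h; simpa using this
  have h2 : ((p.2 : ℤ) : ZMod L) = 0 := by have := congrArg Prod.snd h; simpa using this
  rw [ZMod.intCast_zmod_eq_zero_iff_dvd] at h1 h2
  have e1 : p.1 = 0 := by
    apply Int.eq_zero_of_dvd_of_natAbs_lt_natAbs h1
    have : ((p.1.natAbs : ℕ) : ℤ) ≤ M := by rw [Int.natCast_natAbs]; exact hp1
    simp only [Int.natAbs_natCast]
    omega
  have e2 : p.2 = 0 := by
    apply Int.eq_zero_of_dvd_of_natAbs_lt_natAbs h2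
    have : ((p.2.natAbs : ℕ) : ℤ) ≤ M := by rw [Int.natCast_natAbs]; exact hp2
    simp only [Int.natAbs_natCast]
    omega
  exact Prod.ext e1 e2

/-- ★ `SingleRegionSplit L M2` holds. [folklore] -/
theorem singleRegionSplit_holds (M2 : ℕ) : SingleRegionSplit L M2 := by
  intro hM φ
  classical
  -- `0 ∉ block1`
  have h0 : (0 : Tor L) ∉ block1 L M2 := by
    unfold block1
    rw [Finset.mem_image]
    rintro ⟨p, hp, hp0⟩
    rw [Finset.mem_erase, B1.mem_box_iff] at hp
    have := toTor_eq_zero_of_small L (M := M2) (by omega) (abs_le.2 ⟨hp.2.1.1, hp.2.1.2⟩)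
      (abs_le.2 ⟨hp.2.2.1, hp.2.2.2⟩) hp0
    exact hp.1 (by rw [this]; rfl)
  have hsub : block1 L M2 ⊆ (Finset.univ : Finset (Tor L)).erase 0 := by
    intro k hk
    rw [Finset.mem_erase]
    exact ⟨fun h => h0 (h ▸ hk), Finset.mem_univ _⟩
  rw [← Finset.add_sum_erase _ _ (Finset.mem_univ (0 : Tor L))]
  rw [← Finset.sum_filter_add_sum_filter_not ((Finset.univ : Finset (Tor L)).erase 0) (fun k => k ∈ block1 L M2)]
  have e1 : ((Finset.univ : Finset (Tor L)).erase 0).filter (fun k => k ∈ block1 L M2) = block1 L M2 := by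
    ext k
    rw [Finset.mem_filter]
    constructor
    · exact fun h => h.2
    · exact fun h => ⟨hsub h, h⟩
  have e2 : ((Finset.univ : Finset (Tor L)).erase 0).filter (fun k => ¬ k ∈ block1 L M2) = outer1 L M2 := by
    unfold outer1
    rfl
  rw [e1, e2]
  ring

/-- ★ `PairRegionSplit L M2` holds. [folklore] -/
theorem pairRegionSplit_holds (M2 : ℕ) : PairRegionSplit L M2 := by
  intro hM φ
  classical
  have hL2 : 2 ≤ L := by omega
  have hK : K1 L ≠ 0 := K1_ne_zero L hL2
  -- `blockP ⊆ T′`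
  have hsub : blockP L M2 ⊆ torPrime L := by
    intro k hk
    unfold blockP at hk
    rw [Finset.mem_image] at hk
    obtain ⟨p, hp, hpk⟩ := hk
    rw [Finset.mem_erase, Finset.mem_erase, Finset.mem_product, Finset.mem_Icc, Finset.mem_Icc] at hp
    obtain ⟨hpm1, hp0, ⟨h1a, h1b⟩, ⟨h2a, h2b⟩⟩ := hp
    unfold torPrime
    rw [Finset.mem_filter]
    refine ⟨Finset.mem_univ _, ?_, ?_⟩
    · intro hk0
      rw [← hpk] at hk0
      have := toTor_eq_zero_of_small L (M := M2 + 1) (by omega) (p := p)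
        (abs_le.2 ⟨by push_cast; linarith, by push_cast; linarith⟩)
        (abs_le.2 ⟨by push_cast; linarith, by push_cast; linarith⟩) hk0
      exact hp0 (by rw [this]; rfl)
    · intro hk1
      -- `toTor (p + (1,0)) = 0` with `p + (1,0)` in the box `M2 + 1`
      have e : B1.toTor L (p + ((1 : ℤ), (0 : ℤ))) = 0 := by
        rw [B1.toTor_add, hpk]
        have : B1.toTor L ((1 : ℤ), (0 : ℤ)) = K1 L := by unfold B1.toTor K1; simp
        rw [this]; exact hk1
      have := toTor_eq_zero_of_small L (M := M2 + 1) (by omega) (p := p + ((1 : ℤ), (0 : ℤ)))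
        (abs_le.2 ⟨by simp only [Prod.fst_add]; push_cast; linarith, by simp only [Prod.fst_add]; push_cast; linarith⟩)
        (abs_le.2 ⟨by simp only [Prod.snd_add]; push_cast; linarith, by simp only [Prod.snd_add]; push_cast; linarith⟩) e
      apply hpm1
      have h1 : p.1 + 1 = 0 := by have := congrArg Prod.fst this; simpa using this
      have h2 : p.2 + 0 = 0 := by have := congrArg Prod.snd this; simpa using this
      exact Prod.ext (by simp only; linarith) (by simp only; linarith)
  -- peel `0` and `−K₁`
  have hmK : -K1 L ∈ (Finset.univ : Finset (Tor L)).erase 0 :=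
    Finset.mem_erase.2 ⟨neg_ne_zero.2 hK, Finset.mem_univ _⟩
  have hT : torPrime L = ((Finset.univ : Finset (Tor L)).erase 0).erase (-K1 L) := by
    ext k
    unfold torPrime
    simp only [Finset.mem_filter, Finset.mem_univ, true_and, Finset.mem_erase, and_true, ne_eq,
      add_eq_zero_iff_eq_neg]
    tauto
  rw [← Finset.add_sum_erase _ _ (Finset.mem_univ (0 : Tor L)), ← Finset.add_sum_erase _ _ hmK, ← hT,
    ← Finset.sum_filter_add_sum_filter_not (torPrime L) (fun k => k ∈ blockP L M2)]
  have e1 : (torPrime L).filter (fun k => k ∈ blockP L M2) = blockP L M2 := by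
    ext k
    rw [Finset.mem_filter]
    constructor
    · exact fun h => h.2
    · exact fun h => ⟨hsub h, h⟩
  have e2 : (torPrime L).filter (fun k => ¬ k ∈ blockP L M2) = outerP L M2 := by
    unfold outerP
    rfl
  rw [e1, e2]
  ring

end OuterMaj

end Summit.HubbardSuperconductivity.HubbardSuperconductivity.Theorems.AnisotropyChord.Transfer.Fibre3

end
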